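import Literature.Probability.RandomPlanarGeometry.ConformalRectangleProofs
import HarnessLib

/-!
# Uniformizing maps with the boundary correspondence along the arcs

Topic `Literature/Probability/RandomPlanarGeometry`. The tree's
`MarkedDomain.exists_isUniformizing_holds` (`ConformalRectangleProofs.lean`) produces, for a
marked Jordan domain `D`, a conformal equivalence `φ : ℍₒ → D` with boundary value the marked
point `D.pt i` at a real point `x i`. The Dirichlet-principle computation of the conformal
modulus (and any argument transporting boundary conditions along a conformal map) needs the
full **boundary correspondence along the arcs**, in both directions, which the same
construction yields (Pommerenke, *Boundary Behaviour of Conformal Maps* (1992), Thm. 2.6 and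
proof of Cor. 2.7: a conformal map of the disc onto a Jordan domain extends to a homeomorphism
of the closures). Everything here is PROVED; no definition is introduced:

* `MarkedDomain.exists_uniformizing_boundaryCorrespondence` — a conformal equivalence
  `φ : ℍₒ → D` together with the real boundary correspondence `g` on the parameter interval
  `[0, S]` carrying all the marks: `g` is continuous and strictly monotone (or antitone) there,
  `φ → D.boundary t` at the real point `g t` within `ℍₒ`, and `φ⁻¹ → g t` at `D.boundary t`
  within `D`;
* `MarkedDomain.exists_uniformizing_arcCorrespondence` — hence a uniformizing datum
  `(φ, g ∘ D.mark)` whose boundary values carry each closed arc `D.arc i` (from the mark `i` to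
  the mark `j`, `D.nextMark i = D.mark j`) onto the closed real interval between `ξ i` and
  `ξ j`, in both directions.

This is the proof of `MarkedDomain.exists_isUniformizing_of_disc` re-run keeping the two outputs
it discards: the boundary value at *every* parameter of `[0, S]` (not only at the marks), and the
inverse limit, which is `JordanDomain.tendsto_symm_nhds` (`HalfPlaneAutomorphism.lean`) applied
to the Carathéodory extension `Ψ ∘ (η ·)` of `φ ∘ C⁻¹`, injective on the closed disc.

## References

* Ch. Pommerenke, *Boundary Behaviour of Conformal Maps*, Springer (1992), Thm. 2.6, Cor. 2.7.
  [PommerenkeBBCM1992]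
* L. V. Ahlfors, *Complex Analysis*, 3rd ed. (1979), Ch. 6 §1.1, Thm. 1. [AhlforsCA1979]
-/

noncomputable section

open Set Filter Topology Complex Metric
open UpperHalfPlane (upperHalfPlaneSet isOpen_upperHalfPlaneSet)

namespace Literature.Probability.RandomPlanarGeometry

namespace MarkedDomain

variable {n : ℕ}

/-- **Uniformizing maps with the real boundary correspondence** (Riemann mapping theorem +
Carathéodory's theorem; Pommerenke (1992), Thm. 2.6 and proof of Cor. 2.7). For every marked
Jordan domain `D` there are a conformal equivalence `φ : ℍₒ → D`, a real function `g` and a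
parameter `S` with all marks `≤ S` such that `g` is strictly monotone or strictly antitone and
continuous on `[0, S]`, `φ` has boundary value `D.boundary t` at the real point `g t` for every
`t ∈ [0, S]`, and `φ⁻¹ w → g t` as `w → D.boundary t` within `D`. Construction: Riemann map
`ψ : D → 𝔻`, Carathéodory extension `Ψ` of `ψ⁻¹`, `Φ = (Ψ|_{∂𝔻})⁻¹`; the boundary point
`p₁ = D.boundary ((S+1)/2)` is sent to `∞` by `φ = ψ⁻¹ ∘ (Φ p₁ ·) ∘ C`, and
`g t = Re C⁻¹((Φ p₁)⁻¹ Φ (D.boundary t))`. [cite: PommerenkeBBCM1992, Thm. 2.6 and Cor. 2.7] -/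
theorem exists_uniformizing_boundaryCorrespondence (D : MarkedDomain n) :
    ∃ (φ : ConformalEquiv upperHalfPlaneSet D.carrier) (g : ℝ → ℝ) (S : ℝ),
      (∀ i, D.mark i ≤ S) ∧
      (StrictMonoOn g (Icc 0 S) ∨ StrictAntiOn g (Icc 0 S)) ∧ ContinuousOn g (Icc 0 S) ∧
      (∀ t ∈ Icc (0 : ℝ) S, φ.HasBoundaryValue (g t) (D.boundary t)) ∧
      (∀ t ∈ Icc (0 : ℝ) S, Tendsto φ.symm (𝓝[D.carrier] (D.boundary t)) (𝓝 (g t : ℂ))) := by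
  -- Riemann map `ψ : D → 𝔻` and the Carathéodory extension `Ψ` of `ψ⁻¹ : 𝔻 → D`
  have hsc : IsSimplyConnected D.carrier :=
    Complex.isSimplyConnected_of_isPreconnected_frontier D.isOpen D.isConnected D.isBounded
      (D.range_boundary ▸ isPreconnected_range D.continuous_boundary)
  obtain ⟨ψ⟩ := (exists_conformalEquiv_ball_holds (U := D.carrier)) D.isOpen hsc D.carrier_ne_univ
  obtain ⟨Ψ, hΨc, hΨeq, hball, hsph⟩ :=
    JordanDomain.exists_continuousOn_extension_holds D.toJordanDomain ψ.symm
  -- the inverse boundary correspondence `Φ : ∂D → ∂𝔻`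
  set Φ : ℂ → ℂ := Function.invFunOn Ψ (sphere 0 1) with hΦdef
  have hΦK : MapsTo Φ (frontier D.carrier) (sphere 0 1) := hsph.surjOn.mapsTo_invFunOn
  have hΨΦ : ∀ p ∈ frontier D.carrier, Ψ (Φ p) = p := fun p hp ↦ hsph.invOn_invFunOn.2 hp
  have hΦc : ContinuousOn Φ (frontier D.carrier) :=
    continuousOn_invFunOn_of_isCompact (isCompact_sphere 0 1) (hΨc.mono sphere_subset_closedBall)
      hsph
  have hΦ1 : ∀ p ∈ frontier D.carrier, ‖Φ p‖ = 1 := fun p hp ↦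
    mem_sphere_zero_iff_norm.1 (hΦK hp)
  -- a parameter `t₁` past all the marks and the boundary point `p₁` sent to `∞`
  obtain ⟨S, hS0, hS1, hmS⟩ := D.exists_mark_le
  set t₁ : ℝ := (S + 1) / 2 with ht₁
  have hSt : S < t₁ := by rw [ht₁]; linarith
  have ht1 : t₁ < 1 := by rw [ht₁]; linarith
  have ht0 : 0 ≤ t₁ := hS0.trans hSt.le
  set p₁ : ℂ := D.boundary t₁ with hp₁
  have hp₁f : p₁ ∈ frontier D.carrier := D.boundary_mem_frontier t₁
  -- boundary points with parameter in `[0, S]` are not `p₁`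
  have hne : ∀ t ∈ Icc (0 : ℝ) S, D.boundary t ≠ p₁ := by
    intro t ht h
    have hts : t = t₁ :=
      D.injOn_boundary ⟨ht.1, (ht.2.trans_lt hSt).trans ht1⟩ ⟨ht0, ht1⟩ h
    exact absurd (ht.2.trans_lt hSt) (by rw [hts]; exact lt_irrefl _)
  set η : ℂ := Φ p₁ with hη
  have hη1 : ‖η‖ = 1 := hΦ1 p₁ hp₁f
  have hη0 : η ≠ 0 := norm_ne_zero_iff.1 (by rw [hη1]; exact one_ne_zero)
  -- the rotated inverse Riemann map `ψ₂ = ψ⁻¹ ∘ (η ·)` and its extension `Ψ₂ = Ψ ∘ (η ·)`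
  set ψ₂ : ConformalEquiv (ball (0 : ℂ) 1) D.carrier := (rotBall η hη1).trans ψ.symm with hψ₂
  set Ψ₂ : ℂ → ℂ := fun w ↦ Ψ (η * w) with hΨ₂
  have hrot : MapsTo (fun w : ℂ ↦ η * w) (closedBall 0 1) (closedBall 0 1) := fun w hw ↦ by
    rw [mem_closedBall_zero_iff] at hw ⊢
    rwa [norm_mul, hη1, one_mul]
  have hΨ₂c : ContinuousOn Ψ₂ (closedBall 0 1) :=
    hΨc.comp (continuous_const_mul η).continuousOn hrot
  have hΨ₂eq : EqOn Ψ₂ ψ₂ (ball 0 1) := fun w hw ↦ hΨeq ((rotBall η hη1).mapsTo hw)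
  have hΨ₂inj : InjOn Ψ₂ (closedBall 0 1) := by
    intro v hv v' hv' hvv'
    exact mul_left_cancel₀ hη0 (hball.injOn (hrot hv) (hrot hv') hvv')
  -- the uniformizing map `φ = ψ₂ ∘ cayley : ℍₒ → D`
  set φ : ConformalEquiv upperHalfPlaneSet D.carrier := cayley.trans ψ₂ with hφ
  have hΨ₂eq' : EqOn Ψ₂ (cayley.symm.trans φ) (ball 0 1) := fun w hw ↦ by
    rw [hΨ₂eq hw]
    change ψ₂ w = ψ₂ (cayley (cayley.symm w))
    rw [cayley.apply_symm_apply hw]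
  -- the rotated circle preimage `w t` of `D.boundary t` and its real Cayley preimage `g t`
  set w : ℝ → ℂ := fun t ↦ η⁻¹ * Φ (D.boundary t) with hw
  set g : ℝ → ℝ := fun t ↦ (cayleyInvFun (w t)).re with hg
  have hw1 : ∀ t, ‖w t‖ = 1 := fun t ↦ by
    rw [hw]
    simp only [norm_mul, norm_inv, hη1, hΦ1 _ (D.boundary_mem_frontier t), inv_one, one_mul]
  have hwne : ∀ t, D.boundary t ≠ p₁ → w t ≠ 1 := by
    intro t ht h1
    apply ht
    have h2 : Φ (D.boundary t) = η := by
      have : η * w t = η := by rw [h1, mul_one]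
      rwa [hw, ← mul_assoc, mul_inv_cancel₀ hη0, one_mul] at this
    rw [← hΨΦ _ (D.boundary_mem_frontier t), h2, hη, hΨΦ _ hp₁f]
  have hcg : ∀ t, D.boundary t ≠ p₁ → cayleyFun (g t) = w t := fun t ht ↦ by
    rw [hg, ← cayleyInvFun_eq_ofReal_re (hw1 t), cayleyFun_cayleyInvFun (hwne t ht)]
  have hΨ₂g : ∀ t, D.boundary t ≠ p₁ → Ψ₂ (cayleyFun (g t)) = D.boundary t := fun t ht ↦ by
    rw [hcg t ht, hΨ₂]
    change Ψ (η * (η⁻¹ * Φ (D.boundary t))) = D.boundary t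
    rw [← mul_assoc, mul_inv_cancel₀ hη0, one_mul, hΨΦ _ (D.boundary_mem_frontier t)]
  -- `g` is continuous and injective, hence strictly monotone or antitone, on `[0, S]`
  have hgc : ContinuousOn g (Icc 0 S) := by
    have h1 : ContinuousOn (fun t ↦ Φ (D.boundary t)) (Icc 0 S) :=
      hΦc.comp D.continuous_boundary.continuousOn fun t _ ↦ D.boundary_mem_frontier t
    have h2 : ContinuousOn w (Icc 0 S) := continuousOn_const.mul h1
    have h3 : ContinuousOn (fun t ↦ cayleyInvFun (w t)) (Icc 0 S) :=
      differentiableOn_cayleyInvFun.continuousOn.comp h2 fun t ht ↦ hwne t (hne t ht)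
    exact continuous_re.comp_continuousOn h3
  have hgi : InjOn g (Icc 0 S) := by
    intro s hs t ht hst
    have h1 : w s = w t := by rw [← hcg s (hne s hs), ← hcg t (hne t ht), hst]
    have h2 : Φ (D.boundary s) = Φ (D.boundary t) := mul_left_cancel₀ (inv_ne_zero hη0) h1
    have h3 : D.boundary s = D.boundary t := by
      rw [← hΨΦ _ (D.boundary_mem_frontier s), h2, hΨΦ _ (D.boundary_mem_frontier t)]
    exact D.injOn_boundary ⟨hs.1, hs.2.trans_lt hS1⟩ ⟨ht.1, ht.2.trans_lt hS1⟩ h3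
  have hgm : StrictMonoOn g (Icc 0 S) ∨ StrictAntiOn g (Icc 0 S) :=
    hgc.strictMonoOn_of_injOn_Icc' hS0 hgi
  -- boundary value `D.boundary t` at `g t`, and the inverse limit
  have hbv : ∀ t ∈ Icc (0 : ℝ) S, φ.HasBoundaryValue (g t) (D.boundary t) := by
    intro t ht
    have h1 : Tendsto φ (𝓝[upperHalfPlaneSet] (g t : ℂ)) (𝓝 (Ψ₂ (cayleyFun (g t)))) :=
      JordanDomain.tendsto_nhdsWithin_of_extension φ hΨ₂c hΨ₂eq' (by simp)
    rw [hΨ₂g _ (hne _ ht)] at h1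
    exact h1
  exact ⟨φ, g, S, hmS, hgm, hgc, hbv, fun t ht ↦
    JordanDomain.tendsto_symm_nhds φ hΨ₂c hΨ₂eq' hΨ₂inj (hbv t ht)⟩

/-- **Arc correspondence of a uniformizing datum** (Pommerenke (1992), Thm. 2.6 and Cor. 2.7:
"every conformal map between Jordan domains extends to a homeomorphism of the closures"). Every
marked Jordan domain `D` has a uniformizing datum `(φ, ξ)` such that, for every arc `D.arc i`
running from the mark `i` to the mark `j` (`D.nextMark i = D.mark j`): at every point `p` of the
closed arc, `φ⁻¹ → r` within `D` for some real `r` in the closed interval between `ξ i` and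
`ξ j` (and `φ⁻¹` stays in `ℍₒ`); and conversely at every real `r` of that interval `φ` has a
boundary value lying on the arc. [cite: PommerenkeBBCM1992, Thm. 2.6 and Cor. 2.7] -/
theorem exists_uniformizing_arcCorrespondence (D : MarkedDomain n) :
    ∃ (φ : ConformalEquiv upperHalfPlaneSet D.carrier) (ξ : Fin n → ℝ), D.IsUniformizing φ ξ ∧
      ∀ i j : Fin n, D.nextMark i = D.mark j →
        (∀ p ∈ D.arc i, ∃ r ∈ uIcc (ξ i) (ξ j),
            Tendsto φ.symm (𝓝[D.carrier] p) (𝓝[upperHalfPlaneSet] (r : ℂ))) ∧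
        (∀ r ∈ uIcc (ξ i) (ξ j), ∃ p ∈ D.arc i,
            Tendsto φ (𝓝[upperHalfPlaneSet] (r : ℂ)) (𝓝 p)) := by
  obtain ⟨φ, g, S, hmS, hgm, hgc, hbv, hinv⟩ := D.exists_uniformizing_boundaryCorrespondence
  have hmI : ∀ i, D.mark i ∈ Icc (0 : ℝ) S := fun i ↦ ⟨(D.mark_mem i).1, hmS i⟩
  refine ⟨φ, fun i ↦ g (D.mark i), ⟨?_, fun i ↦ hbv _ (hmI i)⟩, fun i j hij ↦ ?_⟩
  · exact hgm.imp (fun h a b hab ↦ h (hmI a) (hmI b) (D.strictMono_mark hab))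
      (fun h a b hab ↦ h (hmI a) (hmI b) (D.strictMono_mark hab))
  have hle : D.mark i ≤ D.mark j := by
    have h := D.mark_lt_nextMark i
    rw [hij] at h
    exact h.le
  have hsub : Icc (D.mark i) (D.mark j) ⊆ Icc 0 S := Icc_subset_Icc (hmI i).1 (hmI j).2
  have hsub' : uIcc (D.mark i) (D.mark j) ⊆ Icc 0 S := by rwa [uIcc_of_le hle]
  have harc : D.arc i = D.boundary '' Icc (D.mark i) (D.mark j) := by
    rw [MarkedDomain.arc, hij]
  have hmaps : MapsTo g (uIcc (D.mark i) (D.mark j)) (uIcc (g (D.mark i)) (g (D.mark j))) := by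
    rcases hgm with h | h
    · exact ((h.mono hsub').monotoneOn).mapsTo_uIcc
    · exact ((h.mono hsub').antitoneOn).mapsTo_uIcc
  constructor
  · intro p hp
    rw [harc] at hp
    obtain ⟨t, ht, rfl⟩ := hp
    refine ⟨g t, hmaps (by rwa [uIcc_of_le hle]), tendsto_nhdsWithin_iff.2 ⟨hinv t (hsub ht), ?_⟩⟩
    exact eventually_nhdsWithin_of_forall fun z hz ↦ φ.symm_mapsTo hz
  · intro r hr
    have hIVT : uIcc (g (D.mark i)) (g (D.mark j)) ⊆ g '' uIcc (D.mark i) (D.mark j) :=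
      intermediate_value_uIcc (hgc.mono hsub')
    obtain ⟨t, ht, rfl⟩ := hIVT hr
    rw [uIcc_of_le hle] at ht
    exact ⟨D.boundary t, harc ▸ mem_image_of_mem _ ht, hbv t (hsub ht)⟩

end MarkedDomain

end Literature.Probability.RandomPlanarGeometry

end
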